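import Summits.Ventures.YMGap.RobustBall.RobustStarReceivedSum
import HarnessLib

/-!
# Venture YMGap, track ROBUST-BALL (Y2) — crux Y2-X2-W (the robust vertex-star door on the TIER-2 ball),
# step W4: the WEIGHTED received sum of the robust star array

HONEST FRAMING. WHAT THIS IS: a venture file (cell `pub-ymgap`, track Y2 ROBUST-BALL, seat ds-2), pure
finite-dimensional bookkeeping continuing `RobustStarReceivedSum.lean` (the plain received sum
`Σ_y Krob ≤ R_G^{(d)}(c) + (λ + θ^K·4dλ)/(1−θ)`). For a weight `φ ≥ 1` on the links which is `≤ Φ_b` on the star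
boundary of `s` (`Φ_b ≥ 1`) and an off-column array `E ≥ 0` with WEIGHTED rows `Σ_{z ≠ x} E x z · φ z ≤ λ_φ`,
the robust star array `Krob = Karr + Uarr` of `RobustStarArray.lean` has the weighted received sum
`Σ_y Krob(s; y → x) · φ y ≤ Φ_b · (R_G^{(d)}(c) + (λ_φ + θ^K · 4d λ_φ)/(1 − θ))` for every star link `x`
(`sum_Krob_mul_le`): the Lemma-G part `Karr` lives on the star boundary (weight `≤ Φ_b`, sum `R_G`), and the
Neumann corrections are summed over the boundary links `y` with their weights BEFORE the in-star resolvent bound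
(linearity `superSol_smul` / `sum_superSol`), the weighted summed source being `≤ Φ_b λ_φ` pointwise and
`≤ 4d Φ_b λ_φ` in `ℓ¹`. With `φ(y) = e^{t·reach(s, y)}` this is the e^{t·dist}-weighted received sum that the
WEIGHTED Dobrushin–Shlosman window iteration (`Literature/.../DobrushinShlosmanWeighted.lean`) consumes — no
finite influence radius is needed, so the array of an INFINITE-RANGE (tier-2) member qualifies.
WHAT THIS IS NOT: no measure theory, no number; nothing about the continuum or the Millennium problem.

## References
* H.-O. Georgii, *Gibbs Measures and Phase Transitions* (2011), Remark 8.26; H. Künsch, CMP 84 (1982).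
* The tree: `RobustStarArray.lean`, `RobustStarReceivedSum.lean`, `StarNeumann.lean` (this seat, g7).
-/

noncomputable section

open Finset Function
open Literature.MathematicalPhysics.QuantumFieldTheory
open Literature.MathematicalPhysics.QuantumFieldTheory.Balaban1983to89.StrongCouplingTorusWindow
open Summit.Ventures.YMGap.DSWindow
open Summit.Ventures.YMGap.StarKernel
open Summit.Ventures.YMGap.StarResolventDim (Delta gaugeR)
open Summit.Ventures.YMGap.StarLemmaGDim
open Summit.Ventures.YMGap.StarNeumann

namespace Summit.Ventures.YMGap.RobustStar

variable {d L : ℕ} [NeZero L] {c θ : ℝ} {E : Edge d L → Edge d L → ℝ} {K : ℕ}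

/-! ### Linearity of the super-solution in a scalar -/

/-- **Scaling of the Neumann super-solution**: `U_K[t·w, t·M] = t · U_K[w, M]`. [folklore] -/
theorem superSol_smul {ι : Type*} [DecidableEq ι] (C : ι → ι → ℝ) (S : Finset ι) (w : ι → ℝ) (θ M t : ℝ)
    (K : ℕ) (x : ι) : superSol C S (fun z => t * w z) θ (t * M) K x = t * superSol C S w θ M K x := by
  unfold superSol
  split_ifs with hx
  · rw [iter_smul C S w t K x]; ring
  · rw [mul_zero]

/-! ### The weighted Lemma-G part -/

/-- **Weighted received sum of `Karr`**: for a weight `φ` with `φ ≤ Φ_b` on the star boundary of `s`,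
`Σ_{y ∉ ⋆} Karr(s; y → x) φ y ≤ Φ_b · R_G^{(d)}(c)` for a star link `x` (`Karr` lives on the boundary). [folklore] -/
theorem sum_not_mem_Karr_mul_le (hd : 2 ≤ d) (hL : 3 ≤ L) (hc : 0 ≤ c) (hΔ : 0 < Delta d c) {s : Site d L}
    {φ : Edge d L → ℝ} {Φb : ℝ} (hΦb : ∀ y ∈ starBoundary s, φ y ≤ Φb) {x : Edge d L} (hx : x ∈ vertexStar s) :
    ∑ y ∈ univ.filter (fun y => y ∉ vertexStar s), Karr c s y x * φ y ≤ Φb * gaugeR d c := by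
  rw [← sum_not_mem_Karr_eq_gaugeR hL hc hΔ hx, mul_sum]
  refine sum_le_sum fun y _ => ?_
  by_cases hyb : y ∈ starBoundary s
  · rw [mul_comm (Φb)]
    exact mul_le_mul_of_nonneg_left (hΦb y hyb) (Karr_nonneg hd hc hΔ s y x)
  · rw [Karr_eq_zero_of_not_mem_starBoundary hyb x, zero_mul, mul_zero]

/-! ### The weighted summed source -/

/-- **The weighted summed source is at most `Φ_b λ_φ`**: `Σ_{y ∉ ⋆} φ y · wsrc c E s y x ≤ Φ_b · λ_φ` for a star
link `x`, when `R_G^{(d)}(c) ≤ 1`, `φ ≥ 1` everywhere and `≤ Φ_b` on the star boundary (`Φ_b ≥ 1`), and the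
weighted off-column rows are `≤ λ_φ` (`Σ_{z ≠ x} E x z φ z ≤ λ_φ`). [folklore] -/
theorem sum_not_mem_mul_wsrc_le (hd : 2 ≤ d) (hL : 3 ≤ L) (hc : 0 ≤ c) (hΔ : 0 < Delta d c)
    (hgR : gaugeR d c ≤ 1) (hE : ∀ x z, 0 ≤ E x z) {s : Site d L} {φ : Edge d L → ℝ} (hφ1 : ∀ y, 1 ≤ φ y)
    {Φb : ℝ} (hΦb : ∀ y ∈ starBoundary s, φ y ≤ Φb) (hΦb1 : 1 ≤ Φb) {lamφ : ℝ}
    (hlamφ : ∀ x, ∑ z ∈ univ.erase x, E x z * φ z ≤ lamφ) {x : Edge d L} (hx : x ∈ vertexStar s) :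
    ∑ y ∈ univ.filter (fun y => y ∉ vertexStar s), φ y * wsrc c E s y x ≤ Φb * lamφ := by
  have hgR0 : 0 ≤ gaugeR d c := by
    rw [← sum_Karr_eq_gaugeR hL hc hΔ hx]; exact sum_nonneg fun y _ => Karr_nonneg hd hc hΔ s y x
  unfold wsrc
  simp_rw [mul_add]
  rw [sum_add_distrib]
  -- the in-star part: swap the sums and use the weighted Lemma-G sum at every `z`
  have hin : ∑ y ∈ univ.filter (fun y => y ∉ vertexStar s), φ y * ∑ z ∈ (vertexStar s).erase x, E x z * Karr c s y z
      = ∑ z ∈ (vertexStar s).erase x, E x z * ∑ y ∈ univ.filter (fun y => y ∉ vertexStar s), Karr c s y z * φ y := by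
    simp_rw [mul_sum]
    rw [sum_comm]
    exact sum_congr rfl fun z _ => sum_congr rfl fun y _ => by ring
  have hin_le : ∑ z ∈ (vertexStar s).erase x, E x z * ∑ y ∈ univ.filter (fun y => y ∉ vertexStar s), Karr c s y z * φ y
      ≤ ∑ z ∈ (vertexStar s).erase x, Φb * (E x z * φ z) := by
    refine sum_le_sum fun z hz => ?_
    have h1 := sum_not_mem_Karr_mul_le hd hL hc hΔ (φ := φ) hΦb (mem_of_mem_erase hz)
    calc E x z * ∑ y ∈ univ.filter (fun y => y ∉ vertexStar s), Karr c s y z * φ y ≤ E x z * (Φb * gaugeR d c) :=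
          mul_le_mul_of_nonneg_left h1 (hE x z)
      _ ≤ E x z * (Φb * 1) := by
          refine mul_le_mul_of_nonneg_left (mul_le_mul_of_nonneg_left hgR (by linarith)) (hE x z)
      _ = Φb * (E x z * 1) := by ring
      _ ≤ Φb * (E x z * φ z) :=
          mul_le_mul_of_nonneg_left (mul_le_mul_of_nonneg_left (hφ1 z) (hE x z)) (by linarith)
  -- the out-of-star part
  have hout_le : ∑ y ∈ univ.filter (fun y => y ∉ vertexStar s), φ y * E x y ≤
      ∑ y ∈ univ.filter (fun y => y ∉ vertexStar s), Φb * (E x y * φ y) :=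
    sum_le_sum fun y _ => by
      have h0 : 0 ≤ E x y * φ y := mul_nonneg (hE x y) (by linarith [hφ1 y])
      calc φ y * E x y = 1 * (E x y * φ y) := by ring
        _ ≤ Φb * (E x y * φ y) := mul_le_mul_of_nonneg_right hΦb1 h0
  rw [hin]
  refine (add_le_add hout_le hin_le).trans ?_
  rw [← mul_sum, ← mul_sum, ← mul_add]
  refine mul_le_mul_of_nonneg_left ?_ (by linarith)
  -- both index sets sit inside `univ ∖ {x}` and are disjoint
  have hsplit : ∑ y ∈ univ.filter (fun y => y ∉ vertexStar s), E x y * φ y + ∑ z ∈ (vertexStar s).erase x, E x z * φ z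
      ≤ ∑ z ∈ univ.erase x, E x z * φ z := by
    rw [← sum_union]
    · refine sum_le_sum_of_subset_of_nonneg (fun z hz => ?_) fun z _ _ =>
        mul_nonneg (hE x z) (by linarith [hφ1 z])
      rw [mem_union, mem_filter, mem_erase] at hz
      rcases hz with ⟨-, hz⟩ | ⟨hzx, -⟩
      · exact mem_erase.2 ⟨fun h => hz (h ▸ hx), mem_univ _⟩
      · exact mem_erase.2 ⟨hzx, mem_univ _⟩
    · rw [disjoint_left]
      intro z hz hz'
      exact (mem_filter.1 hz).2 (mem_of_mem_erase hz')
  exact hsplit.trans (hlamφ x)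

/-- **The weighted summed remainder constants**: `Σ_{y ∉ ⋆} φ y · 2 Msrc c E s y ≤ 4d Φ_b λ_φ`. [folklore] -/
theorem sum_not_mem_mul_Msrc_le (hd : 2 ≤ d) (hL : 3 ≤ L) (hc : 0 ≤ c) (hΔ : 0 < Delta d c)
    (hgR : gaugeR d c ≤ 1) (hE : ∀ x z, 0 ≤ E x z) (s : Site d L) {φ : Edge d L → ℝ} (hφ1 : ∀ y, 1 ≤ φ y)
    {Φb : ℝ} (hΦb : ∀ y ∈ starBoundary s, φ y ≤ Φb) (hΦb1 : 1 ≤ Φb) {lamφ : ℝ}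
    (hlamφ : ∀ x, ∑ z ∈ univ.erase x, E x z * φ z ≤ lamφ) :
    ∑ y ∈ univ.filter (fun y => y ∉ vertexStar s), φ y * (2 * Msrc c E s y) ≤ 4 * d * (Φb * lamφ) := by
  have hL1 : 1 < L := by omega
  unfold Msrc
  have hrw : ∀ y, φ y * (2 * ∑ x ∈ vertexStar s, wsrc c E s y x) =
      ∑ x ∈ vertexStar s, 2 * (φ y * wsrc c E s y x) := fun y => by
    rw [mul_sum, mul_sum]
    exact sum_congr rfl fun x _ => by ring
  rw [sum_congr rfl fun y _ => hrw y, sum_comm]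
  have h : ∑ x ∈ vertexStar s, ∑ y ∈ univ.filter (fun y => y ∉ vertexStar s), 2 * (φ y * wsrc c E s y x) ≤
      ∑ x ∈ vertexStar s, 2 * (Φb * lamφ) := by
    refine sum_le_sum fun x hx => ?_
    rw [← mul_sum]
    exact mul_le_mul_of_nonneg_left (sum_not_mem_mul_wsrc_le hd hL hc hΔ hgR hE hφ1 hΦb hΦb1 hlamφ hx) zero_le_two
  refine h.trans (le_of_eq ?_)
  rw [sum_const, card_vertexStar hL1 s, nsmul_eq_mul]
  push_cast
  ring

/-! ### The weighted received sum of the robust star array -/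

/-- **WEIGHTED (H2) FOR THE ROBUST STAR ARRAY.** For a star link `x` of `s` (`d ≥ 2`, side `≥ 3`, `c ≥ 0` below
the pole with `R_G^{(d)}(c) ≤ 1`, `E ≥ 0`, in-star rows of `Cst c E` at most `θ ∈ [0,1)`), a weight `φ ≥ 1` on the
links with `φ ≤ Φ_b` on the star boundary (`Φ_b ≥ 1`) and weighted off-column rows `Σ_{z ≠ x} E x z φ z ≤ λ_φ`:
`Σ_y Krob c E θ K s y x · φ y ≤ Φ_b · (R_G^{(d)}(c) + (λ_φ + θ^K · 4d λ_φ)/(1 − θ))`. With `φ ≡ 1` this is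
`sum_Krob_le`. [folklore] -/
theorem sum_Krob_mul_le (hd : 2 ≤ d) (hL : 3 ≤ L) (hc : 0 ≤ c) (hΔ : 0 < Delta d c) (hgR : gaugeR d c ≤ 1)
    (hE : ∀ x z, 0 ≤ E x z) (hθ0 : 0 ≤ θ) (hθ1 : θ < 1) {s : Site d L}
    (hrow : ∀ x ∈ vertexStar s, ∑ z ∈ (vertexStar s).erase x, Cst c E x z ≤ θ) {φ : Edge d L → ℝ}
    (hφ1 : ∀ y, 1 ≤ φ y) {Φb : ℝ} (hΦb : ∀ y ∈ starBoundary s, φ y ≤ Φb) (hΦb1 : 1 ≤ Φb) {lamφ : ℝ}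
    (hlamφ : ∀ x, ∑ z ∈ univ.erase x, E x z * φ z ≤ lamφ) {x : Edge d L} (hx : x ∈ vertexStar s) :
    ∑ y, Krob c E θ K s y x * φ y ≤ Φb * (gaugeR d c + (lamφ + θ ^ K * (4 * d * lamφ)) / (1 - θ)) := by
  have h1θ : 0 < 1 - θ := by linarith
  have hΦb0 : 0 ≤ Φb := by linarith
  have hlam0 : 0 ≤ lamφ :=
    le_trans (sum_nonneg fun z _ => mul_nonneg (hE x z) (by linarith [hφ1 z])) (hlamφ x)
  -- split off the star
  have hsplit : ∑ y, Krob c E θ K s y x * φ y =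
      ∑ y ∈ univ.filter (fun y => y ∉ vertexStar s), (Karr c s y x * φ y + φ y * Uarr c E θ K s y x) := by
    rw [sum_filter]
    refine sum_congr rfl fun y _ => ?_
    unfold Krob
    split_ifs with hy
    · rw [zero_mul]
    · ring
  rw [hsplit, sum_add_distrib]
  have hK := sum_not_mem_Karr_mul_le hd hL hc hΔ (φ := φ) hΦb hx
  -- the Neumann corrections: scale by the weights, then sum the sources first
  have hU : ∑ y ∈ univ.filter (fun y => y ∉ vertexStar s), φ y * Uarr c E θ K s y x ≤
      Φb * ((lamφ + θ ^ K * (4 * d * lamφ)) / (1 - θ)) := by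
    unfold Uarr
    have hsm : ∀ y ∈ univ.filter (fun y => y ∉ vertexStar s),
        φ y * superSol (Cst c E) (vertexStar s) (wsrc c E s y) θ (2 * Msrc c E s y) K x =
          superSol (Cst c E) (vertexStar s) (fun z => φ y * wsrc c E s y z) θ (φ y * (2 * Msrc c E s y)) K x :=
      fun y _ => (superSol_smul _ _ _ _ _ _ _ _).symm
    rw [sum_congr rfl hsm, sum_superSol]
    refine (superSol_le (Cst_nonneg hc hE) hθ0 hθ1 hrow (M' := Φb * lamφ) (fun x' hx' => ?_)
      (mul_nonneg hΦb0 hlam0) ?_ K x).trans ?_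
    · exact sum_not_mem_mul_wsrc_le hd hL hc hΔ hgR hE hφ1 hΦb hΦb1 hlamφ hx'
    · exact sum_nonneg fun y _ => mul_nonneg (by linarith [hφ1 y])
        (mul_nonneg zero_le_two (Msrc_nonneg hd hc hΔ hE s y))
    · have hM := sum_not_mem_mul_Msrc_le hd hL hc hΔ hgR hE s hφ1 hΦb hΦb1 hlamφ
      have hθK : 0 ≤ θ ^ K := pow_nonneg hθ0 K
      rw [← mul_div_assoc]
      refine div_le_div_of_nonneg_right ?_ h1θ.le
      nlinarith
  calc ∑ y ∈ univ.filter (fun y => y ∉ vertexStar s), Karr c s y x * φ y +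
        ∑ y ∈ univ.filter (fun y => y ∉ vertexStar s), φ y * Uarr c E θ K s y x
      ≤ Φb * gaugeR d c + Φb * ((lamφ + θ ^ K * (4 * d * lamφ)) / (1 - θ)) := add_le_add hK hU
    _ = Φb * (gaugeR d c + (lamφ + θ ^ K * (4 * d * lamφ)) / (1 - θ)) := by ring

/-! ### Locality of the robust star array in the off-column rows; star-local weighted row bounds -/

/-- The Neumann iterates on `S` depend on the matrix and the source only through their values on `S`. [folklore] -/
theorem iter_congr_rows {ι : Type*} [DecidableEq ι] {C C' : ι → ι → ℝ} {S : Finset ι} {w w' : ι → ℝ}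
    (hC : ∀ x ∈ S, ∀ z ∈ S, C x z = C' x z) (hw : ∀ x ∈ S, w x = w' x) :
    ∀ (k : ℕ) (x : ι), iter C S w k x = iter C' S w' k x
  | 0, _ => by simp [iter]
  | k + 1, x => by
    by_cases hx : x ∈ S
    · rw [iter_succ_of_mem C w k hx, iter_succ_of_mem C' w' k hx, hw x hx]
      exact congrArg _ (sum_congr rfl fun z hz => by
        rw [hC x hx z (mem_of_mem_erase hz), iter_congr_rows hC hw k z])
    · rw [iter_of_not_mem C w _ hx, iter_of_not_mem C' w' _ hx]

/-- **Locality of the robust star array**: `Krob c E θ K s` depends on the off-column array `E` only through the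
rows of the star links of `s`. [folklore] -/
theorem Krob_congr_rows {E' : Edge d L → Edge d L → ℝ} {s : Site d L}
    (hEE' : ∀ x ∈ vertexStar s, ∀ z, E x z = E' x z) (y x : Edge d L) :
    Krob c E θ K s y x = Krob c E' θ K s y x := by
  have hwsrc : ∀ y, ∀ x ∈ vertexStar s, wsrc c E s y x = wsrc c E' s y x := by
    intro y x hx
    unfold wsrc
    rw [hEE' x hx y]
    exact congrArg _ (sum_congr rfl fun z _ => by rw [hEE' x hx z])
  have hMsrc : ∀ y, Msrc c E s y = Msrc c E' s y := fun y => sum_congr rfl fun x hx => hwsrc y x hx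
  have hCst : ∀ x ∈ vertexStar s, ∀ z ∈ vertexStar s, Cst c E x z = Cst c E' x z := by
    intro x hx z _
    unfold Cst
    rw [hEE' x hx z]
  have hUarr : ∀ y x, Uarr c E θ K s y x = Uarr c E' θ K s y x := by
    intro y x
    unfold Uarr superSol
    split_ifs with hx
    · rw [iter_congr_rows hCst (hwsrc y) K x, hMsrc y]
    · rfl
  unfold Krob
  split_ifs with hy
  · rfl
  · rw [hUarr y x]

/-- **WEIGHTED (H2) FOR THE ROBUST STAR ARRAY, star-local row bounds.** As `sum_Krob_mul_le`, but the weighted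
off-column rows `Σ_{z ≠ x} E x z φ z ≤ λ_φ` are required at the STAR LINKS `x ∈ ⋆` only (by locality,
`Krob_congr_rows`, the other rows of `E` are never read) — the form a vertex-dependent weight `φ = e^{t·reach(s,·)}`
can satisfy uniformly in the torus side. [folklore] -/
theorem sum_Krob_mul_le' (hd : 2 ≤ d) (hL : 3 ≤ L) (hc : 0 ≤ c) (hΔ : 0 < Delta d c) (hgR : gaugeR d c ≤ 1)
    (hE : ∀ x z, 0 ≤ E x z) (hθ0 : 0 ≤ θ) (hθ1 : θ < 1) {s : Site d L}
    (hrow : ∀ x ∈ vertexStar s, ∑ z ∈ (vertexStar s).erase x, Cst c E x z ≤ θ) {φ : Edge d L → ℝ}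
    (hφ1 : ∀ y, 1 ≤ φ y) {Φb : ℝ} (hΦb : ∀ y ∈ starBoundary s, φ y ≤ Φb) (hΦb1 : 1 ≤ Φb) {lamφ : ℝ}
    (hlamφ : ∀ x ∈ vertexStar s, ∑ z ∈ univ.erase x, E x z * φ z ≤ lamφ) {x : Edge d L}
    (hx : x ∈ vertexStar s) :
    ∑ y, Krob c E θ K s y x * φ y ≤ Φb * (gaugeR d c + (lamφ + θ ^ K * (4 * d * lamφ)) / (1 - θ)) := by
  classical
  -- restrict `E` to the rows of the star links
  set E' : Edge d L → Edge d L → ℝ := fun x z => if x ∈ vertexStar s then E x z else 0 with hE'def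
  have hEE' : ∀ x ∈ vertexStar s, ∀ z, E x z = E' x z := fun x hx z => by simp only [hE'def, if_pos hx]
  have hE' : ∀ x z, 0 ≤ E' x z := fun x z => by
    simp only [hE'def]
    split_ifs
    · exact hE x z
    · exact le_rfl
  have hlam0 : 0 ≤ lamφ :=
    le_trans (sum_nonneg fun z _ => mul_nonneg (hE x z) (by linarith [hφ1 z])) (hlamφ x hx)
  have hrow' : ∀ x ∈ vertexStar s, ∑ z ∈ (vertexStar s).erase x, Cst c E' x z ≤ θ := by
    intro x hx
    refine le_of_eq_of_le (sum_congr rfl fun z _ => ?_) (hrow x hx)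
    unfold Cst
    rw [hEE' x hx z]
  have hlamφ' : ∀ x, ∑ z ∈ univ.erase x, E' x z * φ z ≤ lamφ := by
    intro x
    by_cases hx : x ∈ vertexStar s
    · refine le_of_eq_of_le (sum_congr rfl fun z _ => ?_) (hlamφ x hx)
      rw [hEE' x hx z]
    · refine le_of_eq_of_le (sum_eq_zero fun z _ => ?_) hlam0
      simp only [hE'def, if_neg hx, zero_mul]
  rw [sum_congr rfl fun y _ => by rw [Krob_congr_rows (c := c) (θ := θ) (K := K) hEE' y x]]
  exact sum_Krob_mul_le hd hL hc hΔ hgR hE' hθ0 hθ1 hrow' hφ1 hΦb hΦb1 hlamφ' hx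

end Summit.Ventures.YMGap.RobustStar

end
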